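/-
Copyright (c) 2026. All rights reserved.
Released under Apache 2.0 license as described in the file LICENSE.
-/
import Literature.MathematicalPhysics.QuantumLattice.HartreeFockBlochTorusTTPrime
import Literature.MathematicalPhysics.QuantumLattice.HartreeFockBlochMixture
import Literature.MathematicalPhysics.QuantumLattice.HubbardNNNHoppingEnergyDensityTilingAnyParity
import Literature.MathematicalPhysics.QuantumLattice.HubbardTTPrimeEnergyDensityVariationalPrinciple
import HarnessLib

/-!
# Bloch-state upper bounds for NON-idempotent blocks `0 ≤ Q ≤ 1` in the `t–t'` Hubbard model
# (Lieb's variational principle, collinear case, next-nearest-neighbour hopping)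

Topic `MathematicalPhysics/QuantumLattice`, family `hubbard`; the `t' ≠ 0` twin of
`HartreeFockBlochMixture.lean` (which is deliberately `t' = 0`), over `HartreeFockBlochTorusTTPrime.lean`.
For the published `t–t'` Hamiltonian on the square torus (`hubbardTorusTT' L t t' U`, Xu et al. 2024
eq. (1)) and a collinear Bloch state with cell-momentum blocks `Q σ κ` on a magnetic cell of sides
`M i ≥ 2` (`k i · M i = L`, `L ≥ 3`), `HartreeFockBlochTorusTTPrime.lean` bounds the torus energy by the
cell expression `blochEnergyTT' t t' U Q = blochEnergy t U Q - t'·blochDiag Q` when the blocks are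
Hermitian IDEMPOTENTS. This file removes idempotency: for `U ≥ 0` and every family with
`0 ≤ Q σ κ ≤ 1` (Loewner), at the mean filling `n̄ = re Σ tr Q σ κ / L² ∈ (0,2)`,

* **`energyDensityTT'_le_blochTT'_of_posSemidef`** —
  `e(t, t', U; n̄) ≤ re blochEnergyTT' t t' U Q / L² + (16|t| + 32|t'|)/L`.

This is Lieb's variational principle `E^Q ≤ E^{HF}(γ)` for all one-body `0 ≤ γ ≤ 1` (BLS94
(2c.34)–(2c.36), Lieb 1981) in the spin-diagonal setting, by the elementary product-Bernoulli argument
of the `t' = 0` file, VERBATIM: the diagonal bond term `blochDiag` is LINEAR in the family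
(`blochDiag_sum_smul`), so `blochEnergyTT'` is again affine along one-spin mixtures
(`blochEnergyTT'_sum_smul_of_spin_eq`); the blocks are released one at a time (the tree's `mixFamily`;
`mixFamily_insert`: a released block is the Bernoulli average of its spectral projectors); the base
case `mixture_baseTT'` (every block a projector, an integer particle number `N`) is the torus bound
`hubbardTorusTT'_groundEnergy_le_blochTT'` + the any-parity tiling bound
`energyDensityTT'_le_torus_of_lt` + a supporting line of the convex `e(t,t',U,·)`
(`exists_supporting_line_energyDensityTT'`), the filled member `N = 2L²` (all-ones family,
`re blochEnergyTT' = U L²`: no bond — nearest or diagonal — is a loop when `M i ≥ 2`) being handled by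
`supporting_line_energyDensityTT'_at_two_le`.

Use: the soundness theorem of translation-invariant quasi-free certificates for the `t–t'` model
(`HartreeFockQuasiFreeCertificateTTPrime.lean`): the certificate's blocks satisfy exactly the two
`PosSemidef` hypotheses per block. Deliberately NOT here: the kernel form of the blocks, `L → ∞`.

Everything is proved; no new definitions (the tree's `mixFamily`, `bernoulliProj`, `bernoulliWeight`
are reused); no named facts.

## Mathlib / tree search

Tree (REUSED): `bernoulliProj`, `bernoulliWeight`, `isHermitian_bernoulliProj`, `bernoulliProj_mul_self`,
`trace_bernoulliProj`, `bernoulliWeight_nonneg`, `sum_bernoulliWeight`,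
`sum_bernoulliWeight_smul_bernoulliProj` (`HartreeFockBernoulliDecomposition`); `mixFamily`,
`blochEnergy_sum_smul_of_spin_eq`, `blochEnergy_eq_kinetic_add_interaction`, `blochKinetic_sum_smul`
(`HartreeFockBlochMixture`); `blochDiag`, `blochEnergyTT'`, `hubbardTorusTT'_groundEnergy_le_blochTT'`
(`HartreeFockBlochTorusTTPrime`); `energyDensityTT'_le_torus_of_lt`
(`HubbardNNNHoppingEnergyDensityTilingAnyParity`); `exists_supporting_line_energyDensityTT'`
(`HubbardNNNHoppingEnergyDensityConvex`); `supporting_line_energyDensityTT'_at_two_le`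
(`HubbardTTPrimeEnergyDensityVariationalPrinciple`). Mathlib: `Matrix.IsHermitian.spectral_theorem`,
`IsHermitian.posSemidef_iff_eigenvalues_nonneg`, `posSemidef_diagonal_iff`, `Finset.sum_eq_sum_iff_of_le`,
`Finset.induction_on`. `lean search 'blochTT|Lieb variational t-t'`: only the `t' = 0` file.

## References

* V. Bach, E. H. Lieb, J. P. Solovej, *Generalized Hartree–Fock theory and the Hubbard model*,
  J. Stat. Phys. 76 (1994) 3, eqs. (2c.8), (2c.34)–(2c.36). [BachLiebSolovej1994]
* E. H. Lieb, *Variational principle for many-fermion systems*, PRL 46 (1981) 457, eq. (4). [Lieb1981]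
-/

noncomputable section

namespace Literature.MathematicalPhysics.QuantumLattice

namespace HartreeFock

open Matrix Finset Literature.Probability.LatticeModels HeisenbergTL
open scoped ComplexConjugate ComplexOrder

/-! ### From the Loewner order `0 ≤ A ≤ 1` to the product-Bernoulli decomposition -/

section Bernoulli

variable {n : Type*} [Fintype n] [DecidableEq n] {A : Matrix n n ℂ}

/-- The all-`true` pattern selects the identity: `F_⊤ = U Uᴴ = 1`. [folklore] -/
private theorem bernoulliProj_const_true' (hA : A.IsHermitian) : bernoulliProj hA (fun _ => true) = 1 := by
  unfold bernoulliProj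
  simp only [if_true, diagonal_one, Matrix.mul_one]
  rw [← star_eq_conjTranspose]
  exact Unitary.coe_mul_star_self hA.eigenvectorUnitary

/-- The eigenvalues of `A` with `A ≤ 1` are at most one (`1 - A = U diag(1 - λ) Uᴴ ≥ 0`).
[folklore] -/
private theorem eigenvalues_le_one_of_posSemidef' (hA : A.IsHermitian) (h1 : (1 - A).PosSemidef) (i : n) :
    hA.eigenvalues i ≤ 1 := by
  have key : 1 - A = Unitary.conjStarAlgAut ℂ _ hA.eigenvectorUnitary
      (diagonal (fun i => ((1 - hA.eigenvalues i : ℝ) : ℂ))) := by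
    conv_lhs => rw [hA.spectral_theorem]
    rw [show (1 : Matrix n n ℂ) = Unitary.conjStarAlgAut ℂ _ hA.eigenvectorUnitary 1 from
      (map_one _).symm, ← map_sub]
    congr 1
    rw [← diagonal_one, diagonal_sub]
    congr 1
    funext i
    simp
  have h := h1
  rw [key, Unitary.conjStarAlgAut_apply,
    (Unitary.isUnit_coe (U := hA.eigenvectorUnitary)).posSemidef_star_right_conjugate_iff,
    posSemidef_diagonal_iff] at h
  have hi := h i
  rw [Complex.zero_le_real] at hi
  linarith

/-- The product-Bernoulli weights of `0 ≤ A ≤ 1` (Loewner) are nonnegative. [folklore] -/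
private theorem bernoulliWeight_nonneg_of_posSemidef' (hA : A.IsHermitian) (h0 : A.PosSemidef)
    (h1 : (1 - A).PosSemidef) (ε : n → Bool) : 0 ≤ bernoulliWeight hA ε :=
  bernoulliWeight_nonneg hA (fun i => (hA.posSemidef_iff_eigenvalues_nonneg.mp h0) i)
    (eigenvalues_le_one_of_posSemidef' hA h1) ε

end Bernoulli

/-! ### `blochDiag` is linear, so `blochEnergyTT'` is affine along one-spin mixtures -/

section Affine

variable {k M : Fin 2 → ℕ} [∀ i, NeZero (k i)] [∀ i, NeZero (M i)]

/-- The diagonal bond part is additive in the family. [folklore] -/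
private theorem blochDiag_add (Q R : Fin 2 → RectTorusSite k → Matrix (RectTorusSite M) (RectTorusSite M) ℂ) :
    blochDiag (Q + R) = blochDiag Q + blochDiag R := by
  unfold blochDiag
  simp only [Pi.add_apply, Matrix.add_apply]
  rw [← Finset.sum_add_distrib]
  refine Finset.sum_congr rfl fun σ _ => ?_
  rw [← Finset.sum_add_distrib]
  refine Finset.sum_congr rfl fun κ _ => ?_
  rw [← Finset.sum_add_distrib]
  refine Finset.sum_congr rfl fun p _ => ?_
  ring

/-- The diagonal bond part is homogeneous in the family. [folklore] -/
private theorem blochDiag_smul (c : ℂ)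
    (Q : Fin 2 → RectTorusSite k → Matrix (RectTorusSite M) (RectTorusSite M) ℂ) :
    blochDiag (c • Q) = c * blochDiag Q := by
  unfold blochDiag
  simp only [Pi.smul_apply, Matrix.smul_apply, smul_eq_mul, Finset.mul_sum]
  refine Finset.sum_congr rfl fun σ _ => Finset.sum_congr rfl fun κ _ =>
    Finset.sum_congr rfl fun p _ => ?_
  ring

/-- The diagonal-bond (one-body) part of the `t–t'` Hartree–Fock functional is LINEAR in the one-body
matrix, here over finite combinations of block families. [cite: BachLiebSolovej1994, eq. (2c.8)] -/
theorem blochDiag_sum_smul {ι : Type*} (s : Finset ι) (c : ι → ℂ)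
    (X : ι → Fin 2 → RectTorusSite k → Matrix (RectTorusSite M) (RectTorusSite M) ℂ) :
    blochDiag (∑ e ∈ s, c e • X e) = ∑ e ∈ s, c e * blochDiag (X e) := by
  induction s using Finset.cons_induction with
  | empty =>
    simp only [Finset.sum_empty]
    unfold blochDiag
    simp
  | cons a s ha ih => rw [Finset.sum_cons, Finset.sum_cons, blochDiag_add, blochDiag_smul, ih]

/-- **`blochEnergyTT'` is affine along one-spin mixtures**: if the families `X e` all have the SAME
blocks in spin `τ` and `Σ c = 1`, then `blochEnergyTT' (Σ_e c_e X_e) = Σ_e c_e blochEnergyTT' (X_e)`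
(`blochEnergy` is affine along such mixtures, the diagonal bond term is linear).
[cite: BachLiebSolovej1994, eq. (2c.8)] -/
theorem blochEnergyTT'_sum_smul_of_spin_eq (t t' U : ℝ) {ι : Type*} (s : Finset ι) (c : ι → ℂ)
    (hc : ∑ e ∈ s, c e = 1)
    (X : ι → Fin 2 → RectTorusSite k → Matrix (RectTorusSite M) (RectTorusSite M) ℂ) (τ : Fin 2)
    (G : RectTorusSite k → Matrix (RectTorusSite M) (RectTorusSite M) ℂ) (hG : ∀ e ∈ s, X e τ = G) :
    blochEnergyTT' t t' U (∑ e ∈ s, c e • X e) = ∑ e ∈ s, c e * blochEnergyTT' t t' U (X e) := by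
  unfold blochEnergyTT'
  rw [blochEnergy_sum_smul_of_spin_eq t U s c hc X τ G hG, blochDiag_sum_smul, Finset.mul_sum,
    ← Finset.sum_sub_distrib]
  refine Finset.sum_congr rfl fun e _ => ?_
  ring

end Affine

/-! ### The total trace and the all-ones family -/

section Total

variable {k M : Fin 2 → ℕ} [∀ i, NeZero (k i)] [∀ i, NeZero (M i)]

/-- `Σ_{σ,κ} tr` of a finite combination of families. [folklore] -/
private theorem totalTrace_sum_smul' {ι : Type*} (s : Finset ι) (c : ι → ℂ)
    (X : ι → Fin 2 → RectTorusSite k → Matrix (RectTorusSite M) (RectTorusSite M) ℂ) :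
    (∑ σ, ∑ κ, ((∑ e ∈ s, c e • X e) σ κ).trace) = ∑ e ∈ s, c e * ∑ σ, ∑ κ, (X e σ κ).trace := by
  have h1 : ∀ σ κ, ((∑ e ∈ s, c e • X e) σ κ).trace = ∑ e ∈ s, c e * (X e σ κ).trace := by
    intro σ κ
    rw [Finset.sum_apply, Finset.sum_apply, Matrix.trace_sum]
    refine Finset.sum_congr rfl fun e _ => ?_
    rw [Pi.smul_apply, Pi.smul_apply, Matrix.trace_smul, smul_eq_mul]
  simp_rw [h1]
  calc ∑ σ, ∑ κ, ∑ e ∈ s, c e * (X e σ κ).trace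
      = ∑ σ, ∑ e ∈ s, ∑ κ, c e * (X e σ κ).trace :=
        Finset.sum_congr rfl fun σ _ => Finset.sum_comm
    _ = ∑ e ∈ s, ∑ σ, ∑ κ, c e * (X e σ κ).trace := Finset.sum_comm
    _ = ∑ e ∈ s, c e * ∑ σ, ∑ κ, (X e σ κ).trace := by
        refine Finset.sum_congr rfl fun e _ => ?_
        rw [Finset.mul_sum]
        refine Finset.sum_congr rfl fun σ _ => ?_
        rw [Finset.mul_sum]

omit [∀ i, NeZero (k i)] [∀ i, NeZero (M i)] in
/-- With cell sides `M i ≥ 2` the diagonal step `x̄ ↦ x̄ + e₀ + e₁` inside the cell has no fixed point.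
[folklore] -/
private theorem add_diag_ne (hM : ∀ i, 2 ≤ M i) (p : RectTorusSite M) :
    p + Pi.single 0 1 + Pi.single 1 1 ≠ p := by
  intro h
  have h0 := congrFun h 0
  simp only [Pi.add_apply, Pi.single_eq_same, Pi.single_eq_of_ne (show (0 : Fin 2) ≠ 1 by decide),
    add_zero, add_eq_left] at h0
  haveI : Fact (1 < M 0) := ⟨hM 0⟩
  exact one_ne_zero h0

omit [∀ i, NeZero (k i)] [∀ i, NeZero (M i)] in
/-- With cell sides `M i ≥ 2` the two corners `x̄ + e₀`, `x̄ + e₁` of a plaquette differ.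
[folklore] -/
private theorem add_single_zero_ne_add_single_one (hM : ∀ i, 2 ≤ M i) (p : RectTorusSite M) :
    p + Pi.single 0 1 ≠ p + Pi.single 1 1 := by
  intro h
  have h0 := congrFun h 0
  simp only [Pi.add_apply, Pi.single_eq_same, Pi.single_eq_of_ne (show (0 : Fin 2) ≠ 1 by decide),
    add_zero, add_eq_left] at h0
  haveI : Fact (1 < M 0) := ⟨hM 0⟩
  exact one_ne_zero h0

/-- The diagonal bond part of the all-ones family vanishes (no diagonal bond is a loop when
`M i ≥ 2`). [folklore] -/
private theorem blochDiag_one (hM : ∀ i, 2 ≤ M i) :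
    blochDiag (k := k) (fun (_ : Fin 2) (_ : RectTorusSite k) =>
      (1 : Matrix (RectTorusSite M) (RectTorusSite M) ℂ)) = 0 := by
  unfold blochDiag
  refine Finset.sum_eq_zero fun σ _ => Finset.sum_eq_zero fun κ _ => Finset.sum_eq_zero fun p _ => ?_
  beta_reduce
  rw [Matrix.one_apply_ne (add_diag_ne hM p), Matrix.one_apply_ne' (add_diag_ne hM p),
    Matrix.one_apply_ne (add_single_zero_ne_add_single_one hM p),
    Matrix.one_apply_ne' (add_single_zero_ne_add_single_one hM p)]
  simp only [mul_zero, add_zero]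

/-- `|k| · |cell| = L²`. [folklore] -/
private theorem card_cells_mul_card_cell₂ {L : ℕ} (hkM : ∀ i, k i * M i = L) :
    Fintype.card (RectTorusSite k) * Fintype.card (RectTorusSite M) = L ^ 2 := by
  rw [card_rectTorusSite_eq_prod, card_rectTorusSite_eq_prod, ← Finset.prod_mul_distrib]
  rw [Finset.prod_congr rfl fun i _ => hkM i, Finset.prod_const, Finset.card_univ, Fintype.card_fin]

/-- The `t–t'` Bloch energy of the all-ones family (the filled band) is `U · L²` (the `t' = 0` part is
the tree's computation inside `blochEnergy_sum_smul_of_spin_eq`'s file; the diagonal part vanishes).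
[folklore] -/
private theorem blochEnergyTT'_one {L : ℕ} (hkM : ∀ i, k i * M i = L) (hM : ∀ i, 2 ≤ M i)
    (t t' U : ℝ) :
    blochEnergyTT' t t' U (fun (_ : Fin 2) (_ : RectTorusSite k) =>
      (1 : Matrix (RectTorusSite M) (RectTorusSite M) ℂ)) = (U : ℂ) * ((L ^ 2 : ℕ) : ℂ) := by
  unfold blochEnergyTT'
  rw [blochDiag_one hM, mul_zero, sub_zero, blochEnergy_eq_kinetic_add_interaction]
  -- kinetic part: no nearest-neighbour bond is a loop
  have hkin : blochKinetic (k := k) (fun (_ : Fin 2) (_ : RectTorusSite k) =>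
      (1 : Matrix (RectTorusSite M) (RectTorusSite M) ℂ)) = 0 := by
    unfold blochKinetic
    refine Finset.sum_eq_zero fun σ _ => Finset.sum_eq_zero fun κ _ =>
      Finset.sum_eq_zero fun i _ => Finset.sum_eq_zero fun p _ => ?_
    have hne : p + Pi.single i 1 ≠ p := by
      intro h
      have hi := congrFun h i
      simp only [Pi.add_apply, Pi.single_eq_same, add_eq_left] at hi
      haveI : Fact (1 < M i) := ⟨hM i⟩
      exact one_ne_zero hi
    beta_reduce
    rw [Matrix.one_apply_ne hne, Matrix.one_apply_ne' hne, mul_zero, mul_zero, add_zero]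
  have hdens : ∀ p : RectTorusSite M, blochDensity (k := k) (fun (_ : RectTorusSite k) =>
      (1 : Matrix (RectTorusSite M) (RectTorusSite M) ℂ)) p = 1 := by
    intro p
    unfold blochDensity
    simp only [Matrix.one_apply_eq, Finset.sum_const, Finset.card_univ, nsmul_eq_mul, mul_one]
    exact inv_mul_cancel₀ card_cells_ne_zero
  rw [hkin, mul_zero, zero_add]
  unfold blochInteraction
  simp only [hdens, mul_one, Finset.sum_const, Finset.card_univ, nsmul_eq_mul]
  rw [← card_cells_mul_card_cell₂ hkM]
  push_cast
  ring

end Total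

/-! ### Releasing the blocks one at a time (the tree's `mixFamily`) -/

section Mixture

variable {k M : Fin 2 → ℕ} [∀ i, NeZero (k i)] [∀ i, NeZero (M i)]
  (Q : Fin 2 → RectTorusSite k → Matrix (RectTorusSite M) (RectTorusSite M) ℂ)
  (hQh : ∀ σ κ, (Q σ κ).IsHermitian)

/-- With every block still original the mixture family is `Q`. [folklore] -/
private theorem mixFamily_univ' (E : Fin 2 × RectTorusSite k → RectTorusSite M → Bool) :
    mixFamily Q hQh Finset.univ E = Q := by
  funext σ κ
  simp [mixFamily]

omit [∀ i, NeZero (k i)] in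
/-- With no block original every block is a spectral projector. [folklore] -/
private theorem mixFamily_empty' (E : Fin 2 × RectTorusSite k → RectTorusSite M → Bool) (σ : Fin 2)
    (κ : RectTorusSite k) : mixFamily Q hQh ∅ E σ κ = bernoulliProj (hQh σ κ) (E (σ, κ)) := by
  simp [mixFamily]

omit [∀ i, NeZero (k i)] in
/-- Changing the pattern of block `b` does not change the blocks of the other spin. [folklore] -/
private theorem mixFamily_update_of_ne' (S : Finset (Fin 2 × RectTorusSite k))
    (E : Fin 2 × RectTorusSite k → RectTorusSite M → Bool) (b : Fin 2 × RectTorusSite k)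
    (ε : RectTorusSite M → Bool) {τ : Fin 2} (hτ : τ ≠ b.1) :
    mixFamily Q hQh S (Function.update E b ε) τ = mixFamily Q hQh S E τ := by
  funext κ
  have hb : (τ, κ) ≠ b := fun h => hτ (by rw [← h])
  simp [mixFamily, Function.update_of_ne hb]

omit [∀ i, NeZero (k i)] in
/-- **One decomposition step**: releasing block `b ∉ S` writes the family as the product-Bernoulli
average over the patterns of `b` of the families with `b` replaced by its spectral projectors.
[folklore] -/
private theorem mixFamily_insert' (S : Finset (Fin 2 × RectTorusSite k)) {b : Fin 2 × RectTorusSite k}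
    (hb : b ∉ S) (E : Fin 2 × RectTorusSite k → RectTorusSite M → Bool) :
    mixFamily Q hQh (insert b S) E = ∑ ε : RectTorusSite M → Bool,
      (bernoulliWeight (hQh b.1 b.2) ε : ℂ) • mixFamily Q hQh S (Function.update E b ε) := by
  funext σ κ
  rw [Finset.sum_apply, Finset.sum_apply]
  simp only [Pi.smul_apply]
  by_cases hσκ : (σ, κ) = b
  · subst hσκ
    simp only [mixFamily, Finset.mem_insert_self, if_true, if_neg hb, Function.update_self]
    exact (sum_bernoulliWeight_smul_bernoulliProj (hQh σ κ)).symm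
  · have hmem : ((σ, κ) ∈ insert b S) = ((σ, κ) ∈ S) := by
      rw [Finset.mem_insert, eq_iff_iff, or_iff_right hσκ]
    simp only [mixFamily, hmem, Function.update_of_ne hσκ]
    rw [← Finset.sum_smul,
      show ∑ ε : RectTorusSite M → Bool, (bernoulliWeight (hQh b.1 b.2) ε : ℂ) = 1 by
        exact_mod_cast sum_bernoulliWeight (hQh b.1 b.2), one_smul]

end Mixture

/-! ### The Bloch bound for `0 ≤ Q ≤ 1`, `t–t'` model -/

section Thermodynamic

variable {L : ℕ} [NeZero L] {k M : Fin 2 → ℕ} [∀ i, NeZero (k i)] [∀ i, NeZero (M i)]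

/-- Base case of the induction (`t–t'` model): every block a spectral projector. For a supporting line
`e(n̄) + s(x - n̄) ≤ e(x)` of `e = energyDensityTT' t t' U` on `[0, 2)`:
`e(n̄) + s(N/L² - n̄) ≤ re blochEnergyTT' / L² + (16|t| + 32|t'|)/L`, `N = Σ tr` (any natural number:
the any-parity tiling bound); the filled member `N = 2L²` is the all-ones family with
`re blochEnergyTT' = U L²` against `e(n̄) + s(2 - n̄) ≤ U`. [cite: BachLiebSolovej1994, eq. (2c.36)] -/
theorem mixture_baseTT' (hkM : ∀ i, k i * M i = L) (hL : 3 ≤ L) (hM : ∀ i, 2 ≤ M i) (t t' : ℝ)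
    {U : ℝ} (hU : 0 ≤ U) (Q : Fin 2 → RectTorusSite k → Matrix (RectTorusSite M) (RectTorusSite M) ℂ)
    (hQh : ∀ σ κ, (Q σ κ).IsHermitian) {nbar s : ℝ}
    (hs : ∀ x ∈ Set.Ico (0 : ℝ) 2, ThermodynamicLimit.energyDensityTT' t t' U nbar + s * (x - nbar) ≤
      ThermodynamicLimit.energyDensityTT' t t' U x)
    (E : Fin 2 × RectTorusSite k → RectTorusSite M → Bool) :
    ThermodynamicLimit.energyDensityTT' t t' U nbar +
        s * ((∑ σ, ∑ κ, (mixFamily Q hQh ∅ E σ κ).trace).re / (L : ℝ) ^ 2 - nbar) ≤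
      (blochEnergyTT' t t' U (mixFamily Q hQh ∅ E)).re / (L : ℝ) ^ 2 + (16 * |t| + 32 * |t'|) / L := by
  obtain ⟨X, hXdef⟩ : ∃ X, X = mixFamily Q hQh ∅ E := ⟨_, rfl⟩
  rw [← hXdef]
  have hX : ∀ σ κ, X σ κ = bernoulliProj (hQh σ κ) (E (σ, κ)) := by
    rw [hXdef]; exact mixFamily_empty' Q hQh E
  have hL0 : (0 : ℝ) < L := by exact_mod_cast (show 0 < L by omega)
  have hL2 : (0 : ℝ) < (L : ℝ) ^ 2 := by positivity
  have hC0 : 0 ≤ (16 * |t| + 32 * |t'|) / (L : ℝ) := by positivity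
  -- the member's particle number
  obtain ⟨cnt, hcnt⟩ : ∃ cnt : Fin 2 × RectTorusSite k → ℕ,
      ∀ b, cnt b = (Finset.univ.filter fun i => E b i = true).card := ⟨_, fun b => rfl⟩
  obtain ⟨N, hNdef⟩ : ∃ N : ℕ, N = ∑ σ : Fin 2, ∑ κ : RectTorusSite k, cnt (σ, κ) := ⟨_, rfl⟩
  have htr : (∑ σ, ∑ κ, (X σ κ).trace) = (N : ℂ) := by
    rw [hNdef]
    push_cast
    refine Finset.sum_congr rfl fun σ _ => Finset.sum_congr rfl fun κ _ => ?_
    rw [hX, trace_bernoulliProj, hcnt]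
  have htrre : (∑ σ, ∑ κ, (X σ κ).trace).re / (L : ℝ) ^ 2 = (N : ℝ) / (L : ℝ) ^ 2 := by
    rw [htr, Complex.natCast_re]
  rw [htrre]
  have hcard : Fintype.card (RectTorusSite k) * Fintype.card (RectTorusSite M) = L * L := by
    rw [card_cells_mul_card_cell₂ hkM, sq]
  by_cases hlt : N < 2 * (L * L)
  · -- a genuine particle-number sector: HF bound + tiling bound + supporting line
    have h1 := hubbardTorusTT'_groundEnergy_le_blochTT' hkM hL t t' U X
      (fun σ κ => by rw [hX]; exact isHermitian_bernoulliProj _ _)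
      (fun σ κ => by rw [hX]; exact bernoulliProj_mul_self _ _) htr
    have h2 := ThermodynamicLimit.energyDensityTT'_le_torus_of_lt t t' hU (show 1 ≤ L by omega) hlt
    have hNr : (N : ℝ) < 2 * (L : ℝ) ^ 2 := by
      have h' : ((N : ℕ) : ℝ) < ((2 * (L * L) : ℕ) : ℝ) := Nat.cast_lt.mpr hlt
      have h'' : ((2 * (L * L) : ℕ) : ℝ) = 2 * (L : ℝ) ^ 2 := by push_cast; ring
      linarith
    have hx : (N : ℝ) / (L : ℝ) ^ 2 ∈ Set.Ico (0 : ℝ) 2 :=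
      ⟨by positivity, by rw [div_lt_iff₀ hL2]; exact hNr⟩
    have h3 := hs _ hx
    have h4 := div_le_div_of_nonneg_right h1 hL2.le
    linarith
  · -- the filled member: every pattern is all-`true`, the family is all-ones
    have hle : ∀ b ∈ (Finset.univ : Finset (Fin 2 × RectTorusSite k)),
        cnt b ≤ Fintype.card (RectTorusSite M) := by
      intro b _
      rw [hcnt b]
      exact (Finset.card_filter_le _ _).trans (by rw [Finset.card_univ])
    have hsum_le : ∑ b, cnt b ≤ ∑ _b : Fin 2 × RectTorusSite k, Fintype.card (RectTorusSite M) :=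
      Finset.sum_le_sum hle
    have htot : ∑ _b : Fin 2 × RectTorusSite k, Fintype.card (RectTorusSite M) = 2 * (L * L) := by
      rw [Finset.sum_const, Finset.card_univ, Fintype.card_prod, Fintype.card_fin, smul_eq_mul,
        mul_assoc, hcard]
    have hNb : N = ∑ b, cnt b := by rw [hNdef, Fintype.sum_prod_type]
    have hNeq : ∑ b, cnt b = ∑ _b : Fin 2 × RectTorusSite k, Fintype.card (RectTorusSite M) := by
      apply le_antisymm hsum_le
      rw [htot]; rw [← hNb]; omega
    have hall : ∀ b, cnt b = Fintype.card (RectTorusSite M) :=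
      fun b => (Finset.sum_eq_sum_iff_of_le hle).mp hNeq b (Finset.mem_univ b)
    have hE : ∀ b, E b = fun _ => true := by
      intro b
      have hb := hall b
      rw [hcnt b, Finset.card_eq_iff_eq_univ, Finset.eq_univ_iff_forall] at hb
      funext i
      simpa using hb i
    have hX1 : X = fun _ _ => (1 : Matrix (RectTorusSite M) (RectTorusSite M) ℂ) := by
      funext σ κ
      rw [hX, hE, bernoulliProj_const_true']
    have hN2 : (N : ℝ) = 2 * (L : ℝ) ^ 2 := by
      rw [hNb, hNeq, htot]
      push_cast
      ring
    rw [hX1, blochEnergyTT'_one hkM hM, hN2]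
    have h5 := ThermodynamicLimit.supporting_line_energyDensityTT'_at_two_le t t' hU hs
    have h6 : ((U : ℂ) * ((L ^ 2 : ℕ) : ℂ)).re / (L : ℝ) ^ 2 = U := by
      have : ((U : ℂ) * ((L ^ 2 : ℕ) : ℂ)).re = U * (L : ℝ) ^ 2 := by
        rw [← Complex.ofReal_natCast, ← Complex.ofReal_mul, Complex.ofReal_re]
        push_cast
        ring
      rw [this, mul_div_assoc, div_self hL2.ne', mul_one]
    rw [h6, show 2 * (L : ℝ) ^ 2 / (L : ℝ) ^ 2 = 2 by field_simp]
    linarith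

/-- **Bloch-state upper bound for non-idempotent blocks, `t–t'` Hubbard model (Lieb's variational
principle, collinear case).** `U ≥ 0`, `L ≥ 3`, a rectangular magnetic cell with sides `M i ≥ 2`,
`k i · M i = L`, blocks `0 ≤ Q σ κ ≤ 1` (Loewner order) with mean filling
`n̄ = re Σ_{σ,κ} tr Q σ κ / L² ∈ (0, 2)`:

  `e(t, t', U; n̄) ≤ re blochEnergyTT' t t' U Q / L² + (16|t| + 32|t'|)/L`.

Proof: release the blocks one at a time (`mixFamily_insert`: the released block is the
product-Bernoulli average of its spectral projectors; `blochEnergyTT'` is affine along such one-spin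
mixtures and so is the total trace), down to families of projectors (`mixture_baseTT'`). This is BLS94
(2c.36) `E^Q ≤ E^{HF}(γ)` for `0 ≤ γ ≤ 1` in the spin-diagonal `t–t'` Hubbard setting.
[cite: BachLiebSolovej1994, eq. (2c.36)] -/
theorem energyDensityTT'_le_blochTT'_of_posSemidef (hkM : ∀ i, k i * M i = L) (hL : 3 ≤ L)
    (hM : ∀ i, 2 ≤ M i) (t t' : ℝ) {U : ℝ} (hU : 0 ≤ U)
    (Q : Fin 2 → RectTorusSite k → Matrix (RectTorusSite M) (RectTorusSite M) ℂ)
    (hQ0 : ∀ σ κ, (Q σ κ).PosSemidef) (hQ1 : ∀ σ κ, (1 - Q σ κ).PosSemidef)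
    (hn0 : 0 < (∑ σ, ∑ κ, (Q σ κ).trace).re / (L : ℝ) ^ 2)
    (hn2 : (∑ σ, ∑ κ, (Q σ κ).trace).re / (L : ℝ) ^ 2 < 2) :
    ThermodynamicLimit.energyDensityTT' t t' U ((∑ σ, ∑ κ, (Q σ κ).trace).re / (L : ℝ) ^ 2) ≤
      (blochEnergyTT' t t' U Q).re / (L : ℝ) ^ 2 + (16 * |t| + 32 * |t'|) / L := by
  set nbar := (∑ σ, ∑ κ, (Q σ κ).trace).re / (L : ℝ) ^ 2 with hnbar
  set C : ℝ := (16 * |t| + 32 * |t'|) / (L : ℝ) with hC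
  have hQh : ∀ σ κ, (Q σ κ).IsHermitian := fun σ κ => (hQ0 σ κ).isHermitian
  obtain ⟨s, hs⟩ := ThermodynamicLimit.exists_supporting_line_energyDensityTT' t t' hU hn0 hn2
  suffices key : ∀ S : Finset (Fin 2 × RectTorusSite k),
      ∀ E : Fin 2 × RectTorusSite k → RectTorusSite M → Bool,
        ThermodynamicLimit.energyDensityTT' t t' U nbar +
            s * ((∑ σ, ∑ κ, (mixFamily Q hQh S E σ κ).trace).re / (L : ℝ) ^ 2 - nbar) ≤
          (blochEnergyTT' t t' U (mixFamily Q hQh S E)).re / (L : ℝ) ^ 2 + C by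
    have h := key Finset.univ (fun _ _ => true)
    rw [mixFamily_univ'] at h
    have h0 : (∑ σ, ∑ κ, (Q σ κ).trace).re / (L : ℝ) ^ 2 - nbar = 0 := by rw [hnbar, sub_self]
    rw [h0, mul_zero, add_zero] at h
    exact h
  intro S
  induction S using Finset.induction_on with
  | empty => exact fun E => mixture_baseTT' hkM hL hM t t' hU Q hQh hs E
  | @insert b S' hb ih =>
    intro E
    rw [mixFamily_insert' Q hQh S' hb E]
    set w : (RectTorusSite M → Bool) → ℝ := fun ε => bernoulliWeight (hQh b.1 b.2) ε with hw
    set Y : (RectTorusSite M → Bool) → Fin 2 → RectTorusSite k →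
        Matrix (RectTorusSite M) (RectTorusSite M) ℂ := fun ε => mixFamily Q hQh S' (Function.update E b ε)
      with hY
    have hw0 : ∀ ε, 0 ≤ w ε := fun ε =>
      bernoulliWeight_nonneg_of_posSemidef' _ (hQ0 b.1 b.2) (hQ1 b.1 b.2) ε
    have hw1 : ∑ ε, w ε = 1 := sum_bernoulliWeight _
    have hw1c : ∑ ε, (w ε : ℂ) = 1 := by exact_mod_cast hw1
    have hτ : b.1 + 1 ≠ b.1 := by
      have h2 : ∀ x : Fin 2, x + 1 ≠ x := by decide
      exact h2 b.1
    have hG : ∀ ε ∈ (Finset.univ : Finset (RectTorusSite M → Bool)),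
        Y ε (b.1 + 1) = mixFamily Q hQh S' E (b.1 + 1) :=
      fun ε _ => mixFamily_update_of_ne' Q hQh S' E b ε hτ
    have hE : blochEnergyTT' t t' U (∑ ε, (w ε : ℂ) • Y ε) =
        ∑ ε, (w ε : ℂ) * blochEnergyTT' t t' U (Y ε) :=
      blochEnergyTT'_sum_smul_of_spin_eq t t' U Finset.univ (fun ε => (w ε : ℂ)) hw1c Y (b.1 + 1)
        (mixFamily Q hQh S' E (b.1 + 1)) hG
    have hEre : (blochEnergyTT' t t' U (∑ ε, (w ε : ℂ) • Y ε)).re =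
        ∑ ε, w ε * (blochEnergyTT' t t' U (Y ε)).re := by
      rw [hE, Complex.re_sum]
      refine Finset.sum_congr rfl fun ε _ => ?_
      rw [Complex.re_ofReal_mul]
    have hN : (∑ σ, ∑ κ, ((∑ ε, (w ε : ℂ) • Y ε) σ κ).trace).re =
        ∑ ε, w ε * (∑ σ, ∑ κ, (Y ε σ κ).trace).re := by
      rw [totalTrace_sum_smul', Complex.re_sum]
      refine Finset.sum_congr rfl fun ε _ => ?_
      rw [Complex.re_ofReal_mul]
    change ThermodynamicLimit.energyDensityTT' t t' U nbar +
        s * ((∑ σ, ∑ κ, ((∑ ε, (w ε : ℂ) • Y ε) σ κ).trace).re / (L : ℝ) ^ 2 - nbar) ≤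
      (blochEnergyTT' t t' U (∑ ε, (w ε : ℂ) • Y ε)).re / (L : ℝ) ^ 2 + C
    rw [hEre, hN]
    -- both sides are the `w`-averages of the members' sides
    have key : ∑ ε, w ε * (ThermodynamicLimit.energyDensityTT' t t' U nbar +
        s * ((∑ σ, ∑ κ, (Y ε σ κ).trace).re / (L : ℝ) ^ 2 - nbar)) ≤
        ∑ ε, w ε * ((blochEnergyTT' t t' U (Y ε)).re / (L : ℝ) ^ 2 + C) :=
      Finset.sum_le_sum fun ε _ => mul_le_mul_of_nonneg_left (ih (Function.update E b ε)) (hw0 ε)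
    have hA : ∑ ε, w ε * ThermodynamicLimit.energyDensityTT' t t' U nbar =
        ThermodynamicLimit.energyDensityTT' t t' U nbar := by rw [← Finset.sum_mul, hw1, one_mul]
    have hB : ∑ ε, w ε * (s * nbar) = s * nbar := by rw [← Finset.sum_mul, hw1, one_mul]
    have hCC : ∑ ε, w ε * C = C := by rw [← Finset.sum_mul, hw1, one_mul]
    have hD : ∑ ε, w ε * (s * ((∑ σ, ∑ κ, (Y ε σ κ).trace).re / (L : ℝ) ^ 2)) =
        s * (∑ ε, w ε * (∑ σ, ∑ κ, (Y ε σ κ).trace).re) / (L : ℝ) ^ 2 := by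
      rw [Finset.mul_sum, Finset.sum_div]
      exact Finset.sum_congr rfl fun ε _ => by ring
    have hF : ∑ ε, w ε * ((blochEnergyTT' t t' U (Y ε)).re / (L : ℝ) ^ 2) =
        (∑ ε, w ε * (blochEnergyTT' t t' U (Y ε)).re) / (L : ℝ) ^ 2 := by
      rw [Finset.sum_div]
      exact Finset.sum_congr rfl fun ε _ => by ring
    have hsplitL : ∀ ε, w ε * (ThermodynamicLimit.energyDensityTT' t t' U nbar +
        s * ((∑ σ, ∑ κ, (Y ε σ κ).trace).re / (L : ℝ) ^ 2 - nbar)) =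
        w ε * ThermodynamicLimit.energyDensityTT' t t' U nbar +
          (w ε * (s * ((∑ σ, ∑ κ, (Y ε σ κ).trace).re / (L : ℝ) ^ 2)) - w ε * (s * nbar)) :=
      fun ε => by ring
    have hsplitR : ∀ ε, w ε * ((blochEnergyTT' t t' U (Y ε)).re / (L : ℝ) ^ 2 + C) =
        w ε * ((blochEnergyTT' t t' U (Y ε)).re / (L : ℝ) ^ 2) + w ε * C :=
      fun ε => by ring
    have eqL : ∑ ε, w ε * (ThermodynamicLimit.energyDensityTT' t t' U nbar +
        s * ((∑ σ, ∑ κ, (Y ε σ κ).trace).re / (L : ℝ) ^ 2 - nbar)) =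
        ThermodynamicLimit.energyDensityTT' t t' U nbar +
          s * ((∑ ε, w ε * (∑ σ, ∑ κ, (Y ε σ κ).trace).re) / (L : ℝ) ^ 2 - nbar) := by
      rw [Finset.sum_congr rfl fun ε _ => hsplitL ε, Finset.sum_add_distrib, Finset.sum_sub_distrib,
        hA, hB, hD]
      ring
    have eqR : ∑ ε, w ε * ((blochEnergyTT' t t' U (Y ε)).re / (L : ℝ) ^ 2 + C) =
        (∑ ε, w ε * (blochEnergyTT' t t' U (Y ε)).re) / (L : ℝ) ^ 2 + C := by
      rw [Finset.sum_congr rfl fun ε _ => hsplitR ε, Finset.sum_add_distrib, hCC, hF]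
    linarith [key, eqL, eqR]

end Thermodynamic

end HartreeFock

end Literature.MathematicalPhysics.QuantumLattice
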